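/-
Copyright (c) 2026 the pub-hodgecm-mathlib formalisation cell (harness21).  Prover seat hodgecm-mathlib-LH7-p09 (g0), re-dealt by director s1969 (a) to strike line L3
`stub_N6nsDyadic` (Track A «(D-RAM) FOUR-FRAME» squad F0∕P3c∕LH4); heir LEAD F0P3a-plan (g21) T20-18 (R-36)(3) «LH7-p09 → (L-P)»; β₂ sub-dealer LH4-p04 (g8) β₂-BOARD v1
row (L-P) «ZERO_t off the pure list — sum∕count half» (holder LH7-p09 (g0), with LH4-p15 (axis instances), LH4-p16 (tube-face instances)).  2026-09-04.
-/
import Summits.HodgeConjecture.HodgeConjecture.Theorems.F0P3cDyRamConeCellFaceTube   -- ★ p861208 (LH4-p16 (g0)) §1: `finsum_mem_inter_eq_of_equiv_exchange`, `finsum_mem_const_eq_mul_ncard`; brings ★ p860765 `ncard_sep_eq_ncard_sep_of_equiv`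
import HarnessLib

/-!
# Crux `H413`, line LH4 «(D-RAM) FOUR-FRAME» — STAGE-1b, row (2) of `f_{T₊}`, the (β₂) road «PURE-CELL LEDGER» (R-36): row (L-P), THE SUM∕COUNT HALF — when does ONE cell's
# labelled difference `cellDiff` VANISH (exchange ∕ no labelled vertex ∕ unpopulated fibres), and what is it on a PURE cell (± the weighted size; constant weight ⇒ `c·#cell`)

Cell `hodgecm-mathlib` (D-0151), FLOOR 0, crux item H413 = `stmt-HodgeConjecture-24833`, route of record `HCCMUnconditional`; squad F0∕P3c∕LH4; lane
`--supports stmt-HodgeConjecture-24833 --as helper` (count-neutral; pays NO tier-0 row).  THEOREMS ONLY (no `def`, no instance, no notation, no `sorry`, default heartbeats).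
DATUM-FREE and MODEL-FREE: an arbitrary type `X` of «plane lattices», a cell `S : Set X`, two labels `P Q : X → Prop`, a weight `f : X → ℕ`.

WHY.  β₂-BOARD v1 (LH4-p04 (g8), re-cut on heir LEAD T20-18's road (R-36)) §0 fixes the currency of the (β₂) letter per literal `t`: after ★-cand (S4-cells-A)
`F0P3cDyRamLabelledCensusCells.transvPlus_sub_cleanMinus_block_eq_cells`, `T₊ᵗ − T−′ᵗ = Σ_j [IsOrd_j lam]·cellDiff_t(j,0) + Σ_{b ∈ [1,R]} Σ_j [IsOrd_j lam]·cellDiff_t(j,b)` with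
AXIS cells `cellDiff_t(j,0) := (#(levelSet_t(j,0) ∩ {q₀₊ᵗ}) : ℤ) − #(levelSet_t(j,0) ∩ {q₀₋ᵗ})` and CONE cells `cellDiff_t(j,b) := (Σᶠ_{levelSetDep_t(j,b) ∩ {q₊ᵗ_b}} f_t b j : ℤ) −
Σᶠ_{levelSetDep_t(j,b) ∩ {q₋ᵗ_b}} f_t b j`.  Row (L-P) is `ZERO_t`: `cellDiff_t(j,b) = 0` for every cell OFF the pure list `P_t` — by a label EXCHANGE on the populated balanced cells
(the symmetry `τ` = a similitude ∕ order-unit flip: ★ p860839, ★ #615 p861174, ★ p860971, ★ p861154 (axis, LH4-p15), ★ p861208 ∕ p861237 (tube faces, LH4-p16)), and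
TRIVIALLY on cells with no labelled vertex (cdis1 BETA2-CELLCHECK v1 §1b: «lit2 has NO labelled clean vertex») or with vanishing weight (unpopulated glue fibres, `f = #Sol_{2b} = 0`
above the conductor, ★ T1).  THIS FILE is that sum∕count half, ONCE, in the two literal shapes of §0 (`S ∩ {x | P x}` under `Set.ncard` resp. `finsum`, cast to `ℤ`):
* §1 CONE cells (weighted): `cellDiff = 0` from a two-label exchange `τ : X ≃ X` (cell-preserving, weight-invariant on the cell, `P → Q ∘ τ`, `Q → P ∘ τ⁻¹` — ★ p861208 §1
  `finsum_mem_inter_eq_of_equiv_exchange`); from «no `P`- and no `Q`-vertex on the cell»; from «weight zero on the labelled part»; PURE cells: `cellDiff = Σᶠ_{S ∩ P} f` resp.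
  `−Σᶠ_{S ∩ Q} f`; a weight CONSTANT on the labelled part sums to `c·#(S ∩ {label})` (★ `finsum_mem_const_eq_mul_ncard`).
* §2 AXIS cells (plain counts, `S` finite or not): the same list with `Set.ncard` (exchange via ★ p860765 `ncard_sep_eq_ncard_sep_of_equiv`'s bijection).
So a producer of an (L-P) instance delivers exactly ONE of: an exchange `τ` on the cell, or the emptiness of both labelled parts, or the vanishing of the weight there; and a producer
of a pure-cell row (L-D)∕(L-S1)∕(L-S2)∕(L-K0) delivers «no `+`-vertex» (resp. «no `−′`-vertex») plus the weighted size.  Nothing here chooses `τ` — that is the geometry of the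
instance files.
HONEST LABEL.  Count-neutral set∕sum bookkeeping; nothing printed is asserted; no census law is stated; (β₂) ∕ `betaT2lit` ∕ `beta2Frame` ∕ `beta2Models` stay HYPOTHESES and
`ZERO_t` ∕ `LEDGER` of the (L-soc) socket stay PRODUCER TARGETS; `HC_CM` is proved only modulo the 7 printed citations (2 remaining named inputs: hLiu418 =
`stmt-HodgeConjecture-24832`, h413 = `stmt-HodgeConjecture-24833`) until rung 0 closes.

## References
* [Kottwitz1986BaseChangeUnits] R. E. Kottwitz, *Base change for unit elements of Hecke algebras*, Compositio Math. 60 (1986), §1 pp. 240–241 (signed fixed-lattice counts, cell by cell).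
* [Rogawski1990] J. D. Rogawski, *Automorphic Representations of Unitary Groups in Three Variables*, Ann. of Math. Stud. 123 (1990), §4.9 Prop. 4.9.1 (b) p. 55 (the labelled census of `f_{T₊}`).
* [LabesseLanglands1979] J.-P. Labesse, R. P. Langlands, *L-indistinguishability for SL(2)*, Canad. J. Math. 31 (1979), §2 p. 8 (sign-reversing involutions on labelled counts).
-/

set_option autoImplicit false

noncomputable section

open scoped Classical
open Summit.HodgeConjecture.HodgeConjecture.Cruxes.H413.F0P3cDyRamConeCellFaceTube (finsum_mem_inter_eq_of_equiv_exchange finsum_mem_const_eq_mul_ncard)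

namespace Summit.HodgeConjecture.HodgeConjecture.Cruxes.H413.F0P3cDyRamCellDiffZero

variable {X : Type*}

/-! ## §1  CONE cells: the weighted labelled difference `(Σᶠ_{S ∩ {P}} f : ℤ) − Σᶠ_{S ∩ {Q}} f` -/

section Cone

/-- **EXCHANGE ⇒ THE WEIGHTED CELL DIFFERENCE VANISHES.**  If `τ : X ≃ X` preserves the cell `S`, the weight `f` is `τ`-invariant on `S`, `τ` carries label `P` to `Q` on `S` and
`τ⁻¹` carries `Q` back to `P` on `S`, then `(Σᶠ_{x ∈ S ∩ {P}} f x : ℤ) − Σᶠ_{x ∈ S ∩ {Q}} f x = 0` (★ p861208 `finsum_mem_inter_eq_of_equiv_exchange`, cast).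
[cite: Kottwitz1986BaseChangeUnits, §1 pp. 240–241] [cite: LabesseLanglands1979, §2 p. 8] -/
theorem natCast_finsum_sub_eq_zero_of_exchange (S : Set X) (τ : X ≃ X) (hτ : ∀ x, τ x ∈ S ↔ x ∈ S) (f : X → ℕ) (hf : ∀ x ∈ S, f (τ x) = f x)
    (P Q : X → Prop) (hPQ : ∀ x ∈ S, P x → Q (τ x)) (hQP : ∀ y ∈ S, Q y → P (τ.symm y)) :
    ((∑ᶠ x ∈ S ∩ {x | P x}, f x : ℕ) : ℤ) - ((∑ᶠ x ∈ S ∩ {x | Q x}, f x : ℕ) : ℤ) = 0 := by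
  rw [finsum_mem_inter_eq_of_equiv_exchange S τ hτ f hf P Q hPQ hQP, sub_self]

/-- **NO `P`-VERTEX ON THE CELL ⇒ `Σᶠ_{S ∩ {P}} f = 0`** (the labelled part is empty). [cite: Kottwitz1986BaseChangeUnits, §1 pp. 240–241] -/
theorem finsum_mem_inter_eq_zero_of_forall_not {N : Type*} [AddCommMonoid N] (S : Set X) (P : X → Prop) (hP : ∀ x ∈ S, ¬ P x) (f : X → N) :
    ∑ᶠ x ∈ S ∩ {x | P x}, f x = 0 := by
  have hS : S ∩ {x | P x} = ∅ := Set.eq_empty_iff_forall_notMem.2 fun x hx => hP x hx.1 hx.2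
  rw [hS, finsum_mem_empty]

/-- **NO LABELLED VERTEX AT ALL ⇒ THE WEIGHTED CELL DIFFERENCE VANISHES** (neither a `P`- nor a `Q`-vertex on `S` — e.g. a cell carrying no clean-shell vertex at this literal).
[cite: Kottwitz1986BaseChangeUnits, §1 pp. 240–241] -/
theorem natCast_finsum_sub_eq_zero_of_forall_not (S : Set X) (P Q : X → Prop) (hP : ∀ x ∈ S, ¬ P x) (hQ : ∀ x ∈ S, ¬ Q x) (f : X → ℕ) :
    ((∑ᶠ x ∈ S ∩ {x | P x}, f x : ℕ) : ℤ) - ((∑ᶠ x ∈ S ∩ {x | Q x}, f x : ℕ) : ℤ) = 0 := by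
  rw [finsum_mem_inter_eq_zero_of_forall_not S P hP f, finsum_mem_inter_eq_zero_of_forall_not S Q hQ f, sub_self]

/-- **WEIGHT ZERO ON THE LABELLED PART ⇒ `Σᶠ_{S ∩ {P}} f = 0`** (unpopulated glue fibres: `f = #Sol_{2b}(r) = 0`). [cite: Kottwitz1986BaseChangeUnits, §1 pp. 240–241] -/
theorem finsum_mem_inter_eq_zero_of_weight_zero {N : Type*} [AddCommMonoid N] (S : Set X) (P : X → Prop) (f : X → N) (hf : ∀ x ∈ S, P x → f x = 0) :
    ∑ᶠ x ∈ S ∩ {x | P x}, f x = 0 :=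
  finsum_mem_eq_zero_of_forall_eq_zero fun x hx => hf x hx.1 hx.2

/-- **WEIGHT ZERO ON THE CELL ⇒ THE WEIGHTED CELL DIFFERENCE VANISHES** (a cell all of whose labelled plane lattices carry EMPTY glue fibres).
[cite: Kottwitz1986BaseChangeUnits, §1 pp. 240–241] -/
theorem natCast_finsum_sub_eq_zero_of_weight_zero (S : Set X) (P Q : X → Prop) (f : X → ℕ) (hf : ∀ x ∈ S, P x ∨ Q x → f x = 0) :
    ((∑ᶠ x ∈ S ∩ {x | P x}, f x : ℕ) : ℤ) - ((∑ᶠ x ∈ S ∩ {x | Q x}, f x : ℕ) : ℤ) = 0 := by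
  rw [finsum_mem_inter_eq_zero_of_weight_zero S P f fun x hx hPx => hf x hx (Or.inl hPx),
    finsum_mem_inter_eq_zero_of_weight_zero S Q f fun x hx hQx => hf x hx (Or.inr hQx), sub_self]

/-- **A PURE `+` CELL** (no `Q`-vertex): the weighted difference IS the weighted `P`-count. [cite: Kottwitz1986BaseChangeUnits, §1 pp. 240–241] -/
theorem natCast_finsum_sub_eq_of_forall_not_right (S : Set X) (P Q : X → Prop) (hQ : ∀ x ∈ S, ¬ Q x) (f : X → ℕ) :
    ((∑ᶠ x ∈ S ∩ {x | P x}, f x : ℕ) : ℤ) - ((∑ᶠ x ∈ S ∩ {x | Q x}, f x : ℕ) : ℤ) = ((∑ᶠ x ∈ S ∩ {x | P x}, f x : ℕ) : ℤ) := by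
  rw [finsum_mem_inter_eq_zero_of_forall_not S Q hQ f, Nat.cast_zero, sub_zero]

/-- **A PURE `−′` CELL** (no `P`-vertex): the weighted difference is MINUS the weighted `Q`-count. [cite: Kottwitz1986BaseChangeUnits, §1 pp. 240–241] -/
theorem natCast_finsum_sub_eq_of_forall_not_left (S : Set X) (P Q : X → Prop) (hP : ∀ x ∈ S, ¬ P x) (f : X → ℕ) :
    ((∑ᶠ x ∈ S ∩ {x | P x}, f x : ℕ) : ℤ) - ((∑ᶠ x ∈ S ∩ {x | Q x}, f x : ℕ) : ℤ) = -((∑ᶠ x ∈ S ∩ {x | Q x}, f x : ℕ) : ℤ) := by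
  rw [finsum_mem_inter_eq_zero_of_forall_not S P hP f, Nat.cast_zero, zero_sub]

/-- **A WEIGHT CONSTANT ON THE LABELLED PART SUMS TO `c · #(S ∩ {P})`** (`Set.ncard`; ★ `finsum_mem_const_eq_mul_ncard` after `finsum_mem_congr`; e.g. `f ≡ q^b` below the glue
conductor, `f ≡ 2q^b` on the populated sub-cell at and above it, ★ T1). [cite: Kottwitz1986BaseChangeUnits, §1 pp. 240–241] -/
theorem finsum_mem_inter_eq_mul_ncard_of_eq_const (S : Set X) (P : X → Prop) (f : X → ℕ) (c : ℕ) (hf : ∀ x ∈ S, P x → f x = c) :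
    ∑ᶠ x ∈ S ∩ {x | P x}, f x = c * (S ∩ {x | P x}).ncard := by
  rw [finsum_mem_congr (s := S ∩ {x | P x}) rfl fun x hx => hf x hx.1 hx.2]
  exact finsum_mem_const_eq_mul_ncard _ c

/-- **A PURE `+` CELL WITH CONSTANT WEIGHT**: `cellDiff = c · #(S ∩ {P})`. [cite: Kottwitz1986BaseChangeUnits, §1 pp. 240–241] -/
theorem natCast_finsum_sub_eq_mul_ncard_of_forall_not_right (S : Set X) (P Q : X → Prop) (hQ : ∀ x ∈ S, ¬ Q x) (f : X → ℕ) (c : ℕ)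
    (hf : ∀ x ∈ S, P x → f x = c) :
    ((∑ᶠ x ∈ S ∩ {x | P x}, f x : ℕ) : ℤ) - ((∑ᶠ x ∈ S ∩ {x | Q x}, f x : ℕ) : ℤ) = (c : ℤ) * ((S ∩ {x | P x}).ncard : ℤ) := by
  rw [natCast_finsum_sub_eq_of_forall_not_right S P Q hQ f, finsum_mem_inter_eq_mul_ncard_of_eq_const S P f c hf, Nat.cast_mul]

/-- **A PURE `−′` CELL WITH CONSTANT WEIGHT**: `cellDiff = −c · #(S ∩ {Q})`. [cite: Kottwitz1986BaseChangeUnits, §1 pp. 240–241] -/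
theorem natCast_finsum_sub_eq_neg_mul_ncard_of_forall_not_left (S : Set X) (P Q : X → Prop) (hP : ∀ x ∈ S, ¬ P x) (f : X → ℕ) (c : ℕ)
    (hf : ∀ x ∈ S, Q x → f x = c) :
    ((∑ᶠ x ∈ S ∩ {x | P x}, f x : ℕ) : ℤ) - ((∑ᶠ x ∈ S ∩ {x | Q x}, f x : ℕ) : ℤ) = -((c : ℤ) * ((S ∩ {x | Q x}).ncard : ℤ)) := by
  rw [natCast_finsum_sub_eq_of_forall_not_left S P Q hP f, finsum_mem_inter_eq_mul_ncard_of_eq_const S Q f c hf, Nat.cast_mul]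

end Cone

/-! ## §2  AXIS cells: the plain labelled difference `(#(S ∩ {P}) : ℤ) − #(S ∩ {Q})` -/

section Axis

/-- **EXCHANGE ⇒ THE TWO LABELLED PARTS ARE EQUINUMEROUS** (`Set.ncard`, no finiteness: ★ p860765 `ncard_sep_eq_ncard_sep_of_equiv`'s bijection `x ↦ τ x`).
[cite: Kottwitz1986BaseChangeUnits, §1 pp. 240–241] [cite: LabesseLanglands1979, §2 p. 8] -/
theorem ncard_inter_eq_of_exchange (S : Set X) (τ : X ≃ X) (hτ : ∀ x, τ x ∈ S ↔ x ∈ S) (P Q : X → Prop)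
    (hPQ : ∀ x ∈ S, P x → Q (τ x)) (hQP : ∀ y ∈ S, Q y → P (τ.symm y)) :
    (S ∩ {x | P x}).ncard = (S ∩ {x | Q x}).ncard := by
  refine Set.ncard_congr (fun x _ => τ x) (fun x hx => ⟨(hτ x).2 hx.1, hPQ x hx.1 hx.2⟩) (fun a b _ _ h => τ.injective h) (fun y hy => ?_)
  have hyS : τ.symm y ∈ S := (hτ (τ.symm y)).1 (by rw [τ.apply_symm_apply]; exact hy.1)
  exact ⟨τ.symm y, ⟨hyS, hQP y hy.1 hy.2⟩, τ.apply_symm_apply y⟩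

/-- **EXCHANGE ⇒ THE AXIS CELL DIFFERENCE VANISHES**: `(#(S ∩ {P}) : ℤ) − #(S ∩ {Q}) = 0`. [cite: Kottwitz1986BaseChangeUnits, §1 pp. 240–241] [cite: LabesseLanglands1979, §2 p. 8] -/
theorem natCast_ncard_sub_eq_zero_of_exchange (S : Set X) (τ : X ≃ X) (hτ : ∀ x, τ x ∈ S ↔ x ∈ S) (P Q : X → Prop)
    (hPQ : ∀ x ∈ S, P x → Q (τ x)) (hQP : ∀ y ∈ S, Q y → P (τ.symm y)) :
    ((S ∩ {x | P x}).ncard : ℤ) - ((S ∩ {x | Q x}).ncard : ℤ) = 0 := by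
  rw [ncard_inter_eq_of_exchange S τ hτ P Q hPQ hQP, sub_self]

/-- **NO `P`-VERTEX ON THE CELL ⇒ `#(S ∩ {P}) = 0`.** [cite: Kottwitz1986BaseChangeUnits, §1 pp. 240–241] -/
theorem ncard_inter_eq_zero_of_forall_not (S : Set X) (P : X → Prop) (hP : ∀ x ∈ S, ¬ P x) : (S ∩ {x | P x}).ncard = 0 := by
  have hS : S ∩ {x | P x} = ∅ := Set.eq_empty_iff_forall_notMem.2 fun x hx => hP x hx.1 hx.2
  rw [hS, Set.ncard_empty]

/-- **NO LABELLED VERTEX AT ALL ⇒ THE AXIS CELL DIFFERENCE VANISHES.** [cite: Kottwitz1986BaseChangeUnits, §1 pp. 240–241] -/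
theorem natCast_ncard_sub_eq_zero_of_forall_not (S : Set X) (P Q : X → Prop) (hP : ∀ x ∈ S, ¬ P x) (hQ : ∀ x ∈ S, ¬ Q x) :
    ((S ∩ {x | P x}).ncard : ℤ) - ((S ∩ {x | Q x}).ncard : ℤ) = 0 := by
  rw [ncard_inter_eq_zero_of_forall_not S P hP, ncard_inter_eq_zero_of_forall_not S Q hQ, sub_self]

/-- **A PURE `+` AXIS CELL** (no `Q`-vertex): the difference IS `#(S ∩ {P})`. [cite: Kottwitz1986BaseChangeUnits, §1 pp. 240–241] -/
theorem natCast_ncard_sub_eq_of_forall_not_right (S : Set X) (P Q : X → Prop) (hQ : ∀ x ∈ S, ¬ Q x) :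
    ((S ∩ {x | P x}).ncard : ℤ) - ((S ∩ {x | Q x}).ncard : ℤ) = ((S ∩ {x | P x}).ncard : ℤ) := by
  rw [ncard_inter_eq_zero_of_forall_not S Q hQ, Nat.cast_zero, sub_zero]

/-- **A PURE `−′` AXIS CELL** (no `P`-vertex): the difference is `−#(S ∩ {Q})`. [cite: Kottwitz1986BaseChangeUnits, §1 pp. 240–241] -/
theorem natCast_ncard_sub_eq_of_forall_not_left (S : Set X) (P Q : X → Prop) (hP : ∀ x ∈ S, ¬ P x) :
    ((S ∩ {x | P x}).ncard : ℤ) - ((S ∩ {x | Q x}).ncard : ℤ) = -((S ∩ {x | Q x}).ncard : ℤ) := by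
  rw [ncard_inter_eq_zero_of_forall_not S P hP, Nat.cast_zero, zero_sub]

end Axis

/-! ## §3  One cell inside a literal's sum: the indicator-weighted summand vanishes with the cell difference -/

/-- **A VANISHING CELL DROPS OUT OF THE LITERAL'S SUM**: the summand `[c]·D` of (S4-cells-A)'s decomposition is `0` whenever `D = 0` (whatever the order condition `c`).
[cite: Rogawski1990, §4.9 Prop. 4.9.1 (b) p. 55] -/
theorem ite_eq_zero_of_eq_zero (c : Prop) [Decidable c] {D : ℤ} (hD : D = 0) : (if c then D else 0) = 0 := by
  rw [hD, ite_self]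

/-- **OFF A FINITE LIST EVERYTHING VANISHES ⇒ THE DOUBLE SUM IS ITS RESTRICTION TO THE LIST** (the shape of the (L-soc) reduction: `Σ_{b ∈ B} Σ_{j ∈ A} [c j]·D j b` equals the same
sum with the summand cut to the pairs `(j, b)` of a finite list `L`, when `D j b = 0` for every `(j, b) ∉ L` with `j ∈ A`, `b ∈ B` and `c j`).
[cite: Rogawski1990, §4.9 Prop. 4.9.1 (b) p. 55] [cite: Kottwitz1986BaseChangeUnits, §1 pp. 240–241] -/
theorem sum_sum_ite_eq_sum_sum_ite_mem_of_zero_off (A B : Finset ℕ) (L : Finset (ℕ × ℕ)) (c : ℕ → Prop) [DecidablePred c] (D : ℕ → ℕ → ℤ)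
    (hD : ∀ j ∈ A, ∀ b ∈ B, (j, b) ∉ L → c j → D j b = 0) :
    ∑ b ∈ B, ∑ j ∈ A, (if c j then D j b else 0) = ∑ b ∈ B, ∑ j ∈ A, (if c j ∧ (j, b) ∈ L then D j b else 0) := by
  refine Finset.sum_congr rfl fun b hb => Finset.sum_congr rfl fun j hj => ?_
  by_cases hc : c j
  · by_cases hL : (j, b) ∈ L
    · rw [if_pos hc, if_pos ⟨hc, hL⟩]
    · rw [if_pos hc, if_neg (fun h => hL h.2), hD j hj b hb hL hc]
  · rw [if_neg hc, if_neg (fun h => hc h.1)]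

/-- **SINGLE-SUM FORM** (the axis row `b = 0`): `Σ_{j ∈ A} [c j]·D j = Σ_{j ∈ A} [c j ∧ j ∈ L₀]·D j` when `D j = 0` off the finite list `L₀`.
[cite: Rogawski1990, §4.9 Prop. 4.9.1 (b) p. 55] -/
theorem sum_ite_eq_sum_ite_mem_of_zero_off (A L₀ : Finset ℕ) (c : ℕ → Prop) [DecidablePred c] (D : ℕ → ℤ)
    (hD : ∀ j ∈ A, j ∉ L₀ → c j → D j = 0) :
    ∑ j ∈ A, (if c j then D j else 0) = ∑ j ∈ A, (if c j ∧ j ∈ L₀ then D j else 0) := by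
  refine Finset.sum_congr rfl fun j hj => ?_
  by_cases hc : c j
  · by_cases hL : j ∈ L₀
    · rw [if_pos hc, if_pos ⟨hc, hL⟩]
    · rw [if_pos hc, if_neg (fun h => hL h.2), hD j hj hL hc]
  · rw [if_neg hc, if_neg (fun h => hc h.1)]

end Summit.HodgeConjecture.HodgeConjecture.Cruxes.H413.F0P3cDyRamCellDiffZero

end
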